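import Literature.AlgebraicGeometry.Frobenioids.Thm36Sub
import Mathlib.CategoryTheory.PEmpty
import HarnessLib

/-!
# Frobenioids II, Thm. 3.6 (i) for `C^ℝ := C^rlf` as the schema `ArchFrd.Thm36Sub.ampleTypes_R π`: the
# universal closure over ARBITRARY bases `π : D ⥤ D₀` is false — at the EMPTY base (FACT-LIST F-2716)

Mochizuki, *The geometry of Frobenioids II: poly-Frobenioids*, Kyushu J. Math. **62** (2008) 401–460, §3,
Example 3.3 (i)–(ii) p. 28 and Theorem 3.6 (i) p. 36: "the Frobenioid `C^Λ` is of `Aut`-ample, `Aut^sub`-ample,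
`End`-ample, and metrically trivial type, but not of group-like type" [cite: MochizukiFrdII2008, Thm 3.6 (i) p.36].

PROOF-ONLY companion (no definitions, no instances) of `Thm36Sub.lean` (abc-iut L1 sub-DAG statements file;
the slot `ampleTypes_R π := Thm36i_ampleTypes (rlfStr π)` over THE realification `C^rlf`); cell abc-iut,
block F, seat abc-iut-f-045 (gen 4).  FACT-LIST row **F-2716** `ArchFrd.Thm36Sub.ampleTypes_R` (R7
TYPE-audit abc-iut-w5-d088: «no EXACT witness of the universal closure»; closer of record
`Thm36Sub.ampleTypes_R_holds (hD : IsGraphConnected D)`, `Thm36SubProofs3.lean`).  The constant quantifies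
over EVERY base functor `π : D ⥤ D₀`, whereas Example 3.3 (i) works over a CONNECTED (in particular
non-empty) base `D` (the standing hypothesis of [FrdI] Def. 1.1 (iv) on base categories — exactly the binder
`hD` of the closer, which is therefore load-bearing).  At the empty base `D = ∅` (`π = Functor.empty D₀`) the
realification `C^rlf` — a category over `D` through its structure functor `rlfStr π : C^rlf → F_{Φ^rlf}`, whose
objects ARE objects of `D` — has no objects, so every "of … type" clause holds vacuously and the last conjunct
"not of group-like type" FAILS.
* `not_forall_ampleTypes_R` — the universal closure of F-2716 (universe `0`) is FALSE.
So the row is admissible AT THE NAMED INSTANCE ONLY (R5: `ampleTypes_R_holds` over a connected base, and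
`thm36i_ampleTypes_C_holds` for the assembled instance statement F-0868) — untouched.  Refuted-closure ≠
refuted-paper; a FACT row is an assumption label, not an endorsement; nothing here bears on [IUTchIII]
Cor. 3.12.
-/

namespace Literature.AlgebraicGeometry.Frobenioids.ArchFrd.Thm36Sub

open CategoryTheory

/-- FACT-LIST **F-2716**: the universal closure of `ArchFrd.Thm36Sub.ampleTypes_R` (universe `0`) is FALSE —
at the empty base `π = Functor.empty D₀` the realification `C^rlf` has no objects (an object would map under
`rlfStr π` to an object of `F_{Φ^rlf}`, i.e. of `D = Discrete PEmpty`), so it IS (vacuously) of group-like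
type.  Instance of record (untouched): `ampleTypes_R_holds (hD : IsGraphConnected D)`.
[cite: MochizukiFrdII2008, Thm 3.6 (i) p.36] -/
theorem not_forall_ampleTypes_R :
    ¬ ∀ {D : Type} [Category.{0} D] (π : D ⥤ D0), ampleTypes_R π := by
  intro h
  exact (h (Functor.empty.{0} D0)).2.2.2.2 fun A => ((rlfStr (Functor.empty.{0} D0)).obj A).as.elim

end Literature.AlgebraicGeometry.Frobenioids.ArchFrd.Thm36Sub
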